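import Literature.MathematicalPhysics.QuantumFieldTheory.Balaban1983to89.LatticeNorms
import Literature.MathematicalPhysics.QuantumFieldTheory.Balaban1983to89.B12PartitionUnity270
import Literature.Analysis.FunctionSpaces.TorusHardCoreCutoff

/-!
# `Balaban1983to89.B12Ineq331Cutoff` — [Balaban1987RG1] p. 276, the sentence after (3.31): *«Obviously such bounds
are satisfied by the function (tζ̃_□ + t_□ζ_□)𝐇_k(B′) for ε₁ sufficiently small.»* — the three members of (3.31)
for a CUT-OFF field `𝐀 = (tζ̃_□ + t_□ζ_□)·F`, PROVED (Leibniz rule for the lattice gradient and its Hölder seminorm),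
with the inputs for the printed product cut-off `ζ_□(x) = Π_μ ζ(M⁻¹(x_μ − y_μ))` of p. 270 DISCHARGED

HONEST FRAMING (cell `lit-balaban`, verbatim): statement-level skeleton of published theorems with citation tags; proofs
where landed; nothing here is a claim about the Yang–Mills mass gap.

CITATION HEADER.  T. Bałaban, *Renormalization group approach to lattice gauge field theories. I. Generation of
effective actions in a small field approximation and a coupling constant renormalization in four dimensions*,
Commun. Math. Phys. **109** (1987) 249–301, doi:10.1007/bf01215223 [Balaban1987RG1] (cell paper B12; held text
`paper:balaban1987-cmp109-rg-i-small-field`, journal page = PDF page + 248; (3.30)–(3.31) and the sentence were read from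
the page render `b2b-balaban-ref1/pages/1987-cmp109-rg-I-small-field/…-p028-x2.png` (p. 276), (3.27) from `…-p027-x2.png`
(p. 275), the profile `ζ` / `ζ_□` from p. 270).  Unit `lit-balaban-r09` gen 7 (reader/typer of B12, Phase 2), SKELETON row
`B12.Eq3.30-3.32` (fold owner r20: the concrete (3.30) `B12QPrime348.lam330` and all three members of (3.32)
`B12Ineq332.*` are theorems; the abstract A-slot of (3.31) is `B12Sec2to5.Lemma4Frame`).  THIS file proves the one
printed sentence of the row that no module quoted so far: that the cut-off field `(tζ̃_□ + t_□ζ_□)𝐇_k(B′)` itself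
satisfies (3.31).

WHAT IS PRINTED (verbatim).  p. 276 [PDF 28], after (3.30): *«Now we define a class of functions 𝐀. We assume that 𝐀 is
regular and satisfies the bounds |𝐀|, |∇^η𝐀|, ‖𝐀‖_{1,β} < α₂ on □₀, (3.31) for 0 ≤ β ≤ β₀ < 1. Obviously such bounds
are satisfied by the function (tζ̃_□ + t_□ζ_□)𝐇_k(B′) for ε₁ sufficiently small. We have similar bounds for the function
𝐇_{k+1}(□₀, (1/i) log V), with α₂ replaced by B₃O(1)Mα₀, and □₀ by □̃⁴, see (3.27).»*  The ingredients, as printed: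
p. 270 [PDF 22] *«ζ_□(x) = Π_{μ=1}^d ζ(M⁻¹(x_μ − y_μ)), where ζ ∈ C₀^∞(R¹), ζ(t) = 1 for |t| ≦ 1/3, ζ(t) = 0 for
|t| ≧ 2/3»* (the profile is CONSTRUCTED in `B12PartitionUnity270.zeta`/`zetaCube`, r09 gen 2); p. 274 [PDF 26] *«Take a
function ζ̃_□ ∈ C₀^∞(□̃₀), ζ̃_□ = 1 on □̃³, ζ̃_□ = 0 outside □̃⁴»* (no formula printed); (3.21) p. 274: `t ∈ [0, 1]`
(the interpolation parameter); (3.15) p. 273 / (3.21): `t_□` runs over a Cauchy circle `|t_□| = r`; (2.9) p. 266: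
`χ_k = Π_b χ({|B′(b)| < ε₁})`, i.e. `|B′| < ε₁`; (3.9) p. 271 and Proposition 9, (190) of [15] (= cell paper B11): the
function `𝐇_k(B′)` and its covariant derivatives are bounded LINEARLY in `B′` (the row's located input `B12Ineq39`).
The norms are those of B5 (1.108)–(1.109) p. 35: `|A| = sup`, `|∇A| = sup |∂_μA_ν|`, `‖A‖_{1,β} = ‖∇A‖_β` with
`‖f‖_β = sup_{|x−x′| ≤ 1} |x − x′|^{−β}|f(x) − f(x′)|` — in the tree `LatticeNorms.supNorm` and
`LatticeNorms.holderSeminorm`/`holderSeminormB5` (identity transport), BY NAME.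

HOW IT IS FORMALIZED (the mechanism behind «obviously»: the Leibniz rule).  Bonds are an arbitrary index type `ι`
(region `S : Finset ι` = the bonds of □₀), values in a seminormed `𝕜`-space `𝔸` (`𝕜` a normed field; in the paper
`𝕜 = ℂ` — `t_□` is complex — and `𝔸 = 𝔤ᶜ`); the lattice gradient is the family `grad c src tgt F k =
c k • (F (tgt k) − F (src k))` over an index type `κ` of (direction, bond) pairs (`c k = η⁻¹`, `tgt k = src k + ηe_ν`),
region `K : Finset κ`; the Hölder seminorm of the gradient is `holderSeminorm β adm dist (fun _ _ ↦ id) K (grad … F)`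
with user-supplied admissibility/distance (B5: same indices, `|x − x′| ≤ 1`).  The cut-off multiplier is
`cutoff t t□ ζ̃ ζ b = t·ζ̃ b + t□·ζ b` (`𝕜`-valued) and `𝐀 = fun b ↦ cutoff … b • F b`.
 §1  one bond / one pair: `a′•x′ − a•x = a′•(x′ − x) + (a′ − a)•x` and its norm form; the LEIBNIZ RULE
     `grad (φ•F) k = φ(tgt k)•grad F k + grad φ k • F(src k)` (`grad_smul`).
 §2  sup norms: `|φF| ≤ Φ·|F|`, `|∇(φF)| ≤ Φ₀|∇F| + |∇φ|·|F|` (`supNorm_smul_le`, `supNorm_grad_smul_le`).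
 §3  Hölder seminorms (identity transport, any `adm`, `dist`): subadditivity `‖f + g‖_β ≤ ‖f‖_β + ‖g‖_β`, products
     `‖aG‖_β ≤ (sup|a|)‖G‖_β + ‖a‖_β(sup|G|)`, scalars `‖t f‖_β ≤ |t|‖f‖_β`.
 §4  THE PRINTED SENTENCE (`norm331_sup_le`, `norm331_grad_le`, `norm331_holder_le`, `ineq331_cutoff_of_small`): with
     `|ζ̃|, |ζ| ≤ 1`, `|t| ≤ 1`, `|t_□| ≤ r`, cut-off gradients `≤ ℓ`, Hölder data of the cut-offs `≤ ℓ′` (values) and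
     `≤ ℓ″` (gradients), and the DISPLAYED inputs for `F = 𝐇_k(B′)` — `|F| ≤ n₀`, `|∇F| ≤ n₁`, `‖∇F‖_β ≤ n₂`, `‖F‖_β ≤ n₃` —
     the three members of (3.31) for `𝐀` are `≤ (1+r)n₀`, `≤ (1+r)(n₁ + ℓn₀)`, `≤ (1+r)(n₂ + ℓ′n₁ + ℓn₃ + ℓ″n₀)`; hence if
     the inputs are linear in `ε₁` (`nᵢ ≤ Cε₁`, the (3.9)/[15] (190) shape combined with `|B′| < ε₁` of (2.9)) then (3.31)
     holds as soon as `(1 + r)(1 + ℓ + ℓ′ + ℓ″)·C·ε₁ < α₂` — the printed «for ε₁ sufficiently small», threshold explicit.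
 §5  THE PRINTED CUT-OFF `ζ_□` (p. 270): for `ζ_□(x) = Π_μ ζ(M⁻¹(x_μ − y_μ))` (`cubeCutoff`; `= B12PartitionUnity270.zetaCube`
     for the constructed profile, `cubeCutoff_zeta`) with ANY profile `0 ≤ ζ ≤ 1`, `ζ` `D`-Lipschitz, `ζ′` `D₂`-Lipschitz:
     `|ζ_□| ≤ 1`, `|ζ_□(x) − ζ_□(x′)| ≤ M⁻¹D|x − x′|₁` (so `|∇^ηζ_□| ≤ M⁻¹D` and the Hölder quotient of `ζ_□` over pairs at
     `ℓ¹`-distance `≤ 1` is `≤ M⁻¹D`), and for the lattice gradient `η⁻¹(ζ_□(x + ηe_ν) − ζ_□(x))`: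
     `|∇_νζ_□(x) − ∇_νζ_□(x′)| ≤ M⁻²(D₂ + D²)|x − x′|₁` (`abs_gradCube_sub_le`) — i.e. `ℓ = ℓ′ = M⁻¹D`, `ℓ″ = M⁻²(D₂ + D²)`
     for this cut-off; and such constants EXIST for the constructed profile (`zeta_profile_constants`: `ζ ∈ C^∞` with compact
     support).  §6 instantiates §4 on the concrete bond carrier `(Fin d → ℝ) × Fin d` (bond = base point, direction) with
     these constants (`ineq331_cube_of_small`): the `ζ_□`-inputs are theorems, the `ζ̃_□`-inputs stay displayed (print gives
     no formula for `ζ̃_□`).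

WHAT IS *NOT* CLAIMED.  (i) The inputs for `F = 𝐇_k(B′)` (its size, gradient and Hölder data, linear in `sup |B′|`) are
HYPOTHESES here, displayed in the printed shape — they are the content of (3.9)/Prop. 9 [15] (row B12.Eq3.9, `B12Ineq39`;
B11 rows), not of this sentence; likewise the regularity inputs of the unprinted `ζ̃_□`.  (ii) The Cauchy-circle
normalisation of `t_□` ((3.15): `r·max{…} = α₂/3`) is not modelled: `r` is a parameter and enters the threshold for
`ε₁`.  (iii) «on □₀»: the regions `S`, `K` are arbitrary finite sets; no cube geometry is asserted.  (iv) The Hölder data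
`‖F‖_β` of `F` itself (input `n₃`) is, on a lattice, bounded by `|∇F|` times a geometric constant (a lattice mean-value
inequality); that reduction is not performed here.  No `Prop`-valued fact is introduced; everything below is a theorem
(or a definition with body) over Mathlib + `LatticeNorms` + `B12PartitionUnity270` +
`Literature.Analysis.FunctionSpaces.TorusHardCoreCutoff` (`abs_prod_sub_prod_le_sum`, BY NAME); axioms standard.
-/

namespace Literature.MathematicalPhysics.QuantumFieldTheory.Balaban1983to89.B12Ineq331Cutoff

open Literature.MathematicalPhysics.QuantumFieldTheory.Balaban1983to89.LatticeNorms (supNorm norm_le_supNorm supNorm_le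
  supNorm_nonneg holderSeminorm holderSeminormB5 holderSeminorm_nonneg holder_bound holderSeminorm_le)

/-! ## §1  One bond / one pair: the Leibniz rule -/

section Pointwise

variable {𝕜 : Type*} [NormedField 𝕜] {𝔸 : Type*} [SeminormedAddCommGroup 𝔸] [NormedSpace 𝕜 𝔸]

/-- `a′•x′ − a•x = a′•(x′ − x) + (a′ − a)•x` — the algebraic identity behind the product rule for differences.
[cite: Balaban1987RG1, (3.31) p.276] (elementary API; our proof) -/
theorem smul_sub_smul_eq (a a' : 𝕜) (x x' : 𝔸) : a' • x' - a • x = a' • (x' - x) + (a' - a) • x := by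
  rw [smul_sub, sub_smul]; abel

/-- `‖a′•x′ − a•x‖ ≤ ‖a′‖·‖x′ − x‖ + ‖a′ − a‖·‖x‖`. [cite: Balaban1987RG1, (3.31) p.276] (elementary API; our proof) -/
theorem norm_smul_sub_smul_le (a a' : 𝕜) (x x' : 𝔸) :
    ‖a' • x' - a • x‖ ≤ ‖a'‖ * ‖x' - x‖ + ‖a' - a‖ * ‖x‖ := by
  rw [smul_sub_smul_eq, ← norm_smul, ← norm_smul]
  exact norm_add_le _ _

end Pointwise

/-! ## §2  The lattice gradient of a product and the sup norms -/

section Grad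

variable {ι κ : Type*} {𝕜 : Type*} [NormedField 𝕜] {𝔸 : Type*} [SeminormedAddCommGroup 𝔸] [NormedSpace 𝕜 𝔸]

/-- The LATTICE GRADIENT as a family of scaled differences: `(∇F)(k) = c k • (F (tgt k) − F (src k))` over an index type
`κ` of (direction, bond) pairs — on the `η`-lattice `c k = η⁻¹`, `src k = b`, `tgt k = b + ηe_ν` (B5 (1.108) p. 35
«|∇A| = max_{μ,ν} sup_x |(∂_μA_ν)(x)|»; the same shape as the gradients of `B12Ineq332` §2–§3, where `c`, `sh`/`src`/`tgt`
are written out).  [cite: Balaban1987RG1, (3.31) p.276] -/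
def grad (c : κ → 𝕜) (src tgt : κ → ι) (F : ι → 𝔸) (k : κ) : 𝔸 := c k • (F (tgt k) - F (src k))

/-- Unfolding of `grad`. [cite: Balaban1987RG1, (3.31) p.276] -/
@[simp] theorem grad_apply (c : κ → 𝕜) (src tgt : κ → ι) (F : ι → 𝔸) (k : κ) :
    grad c src tgt F k = c k • (F (tgt k) - F (src k)) := rfl

/-- The gradient is additive. [cite: Balaban1987RG1, (3.31) p.276] (elementary API; our proof) -/
theorem grad_add (c : κ → 𝕜) (src tgt : κ → ι) (F G : ι → 𝔸) :
    grad c src tgt (F + G) = grad c src tgt F + grad c src tgt G := by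
  funext k
  simp only [grad, Pi.add_apply, smul_sub, smul_add]
  abel

/-- The gradient commutes with constant scalars. [cite: Balaban1987RG1, (3.31) p.276] (elementary API; our proof) -/
theorem grad_const_smul (c : κ → 𝕜) (src tgt : κ → ι) (t : 𝕜) (F : ι → 𝔸) :
    grad c src tgt (fun b => t • F b) = fun k => t • grad c src tgt F k := by
  funext k
  rw [grad, grad, ← smul_sub, smul_comm]

/-- **Leibniz rule for the lattice gradient**: `∇(φF)(k) = φ(tgt k)•∇F(k) + ∇φ(k)•F(src k)` — the mechanism behind
the printed «obviously». [cite: Balaban1987RG1, (3.31) p.276] (our proof) -/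
theorem grad_smul (c : κ → 𝕜) (src tgt : κ → ι) (φ : ι → 𝕜) (F : ι → 𝔸) (k : κ) :
    grad c src tgt (fun b => φ b • F b) k = φ (tgt k) • grad c src tgt F k + grad c src tgt φ k • F (src k) := by
  simp only [grad]
  rw [smul_sub_smul_eq (φ (src k)) (φ (tgt k)) (F (src k)) (F (tgt k)), smul_add,
    smul_smul (c k) (φ (tgt k) - φ (src k)) (F (src k)), smul_comm (c k) (φ (tgt k)) (F (tgt k) - F (src k)),
    smul_eq_mul]

/-- The Leibniz rule as an identity of functions on `κ`. [cite: Balaban1987RG1, (3.31) p.276] (our proof) -/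
theorem grad_smul_eq (c : κ → 𝕜) (src tgt : κ → ι) (φ : ι → 𝕜) (F : ι → 𝔸) :
    grad c src tgt (fun b => φ b • F b) =
      (fun k => φ (tgt k) • grad c src tgt F k) + fun k => grad c src tgt φ k • F (src k) := by
  funext k
  exact grad_smul c src tgt φ F k

/-- Norm form of the Leibniz rule: `‖∇(φF)(k)‖ ≤ ‖φ(tgt k)‖·‖∇F(k)‖ + ‖∇φ(k)‖·‖F(src k)‖`.
[cite: Balaban1987RG1, (3.31) p.276] (our proof) -/
theorem norm_grad_smul_le (c : κ → 𝕜) (src tgt : κ → ι) (φ : ι → 𝕜) (F : ι → 𝔸) (k : κ) :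
    ‖grad c src tgt (fun b => φ b • F b) k‖ ≤
      ‖φ (tgt k)‖ * ‖grad c src tgt F k‖ + ‖grad c src tgt φ k‖ * ‖F (src k)‖ := by
  rw [grad_smul, ← norm_smul, ← norm_smul]
  exact norm_add_le _ _

/-- **Sup norm of a product**: `|φF| ≤ Φ·n` on a finite bond region `S` when `|φ| ≤ Φ` and `|F| ≤ n` there (first member of
(3.31) for the cut-off field). [cite: Balaban1987RG1, (3.31) p.276] (our proof) -/
theorem supNorm_smul_le (S : Finset ι) (φ : ι → 𝕜) (F : ι → 𝔸) {Φ n : ℝ} (hΦ : 0 ≤ Φ) (hn : 0 ≤ n)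
    (hφ : ∀ b ∈ S, ‖φ b‖ ≤ Φ) (hF : ∀ b ∈ S, ‖F b‖ ≤ n) :
    supNorm S (fun b => φ b • F b) ≤ Φ * n :=
  supNorm_le (mul_nonneg hΦ hn) fun b hb => by
    rw [norm_smul]
    exact mul_le_mul (hφ b hb) (hF b hb) (norm_nonneg _) hΦ

/-- **Sup norm of the gradient of a product**: `|∇(φF)| ≤ Φ₀·n₁ + Φ₁·n₀` on a finite gradient region `K` when
`|φ∘tgt| ≤ Φ₀`, `|∇φ| ≤ Φ₁`, `|F∘src| ≤ n₀`, `|∇F| ≤ n₁` on `K` (second member of (3.31) for the cut-off field).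
[cite: Balaban1987RG1, (3.31) p.276] (our proof) -/
theorem supNorm_grad_smul_le (K : Finset κ) (c : κ → 𝕜) (src tgt : κ → ι) (φ : ι → 𝕜) (F : ι → 𝔸)
    {Φ₀ Φ₁ n₀ n₁ : ℝ} (hΦ₀ : 0 ≤ Φ₀) (hΦ₁ : 0 ≤ Φ₁) (hn₀ : 0 ≤ n₀) (hn₁ : 0 ≤ n₁)
    (hφ : ∀ k ∈ K, ‖φ (tgt k)‖ ≤ Φ₀) (hdφ : ∀ k ∈ K, ‖grad c src tgt φ k‖ ≤ Φ₁)
    (hF : ∀ k ∈ K, ‖F (src k)‖ ≤ n₀) (hdF : ∀ k ∈ K, ‖grad c src tgt F k‖ ≤ n₁) :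
    supNorm K (grad c src tgt (fun b => φ b • F b)) ≤ Φ₀ * n₁ + Φ₁ * n₀ :=
  supNorm_le (by positivity) fun k hk =>
    (norm_grad_smul_le c src tgt φ F k).trans
      (add_le_add (mul_le_mul (hφ k hk) (hdF k hk) (norm_nonneg _) hΦ₀)
        (mul_le_mul (hdφ k hk) (hF k hk) (norm_nonneg _) hΦ₁))

end Grad

/-! ## §3  Hölder seminorms (identity transport): sums, products, scalars -/

section Holder

variable {κ : Type*} {𝕜 : Type*} [NormedField 𝕜] {𝔸 : Type*} [SeminormedAddCommGroup 𝔸] [NormedSpace 𝕜 𝔸]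

/-- **Subadditivity** of the Hölder seminorm with identity transport: `‖f + g‖_β ≤ ‖f‖_β + ‖g‖_β`.
[cite: Balaban1984PropagatorsI, (1.109) p.35] (elementary API; our proof) -/
theorem holderSeminorm_add_le (β : ℝ) (adm : κ → κ → Prop) (dist : κ → κ → ℝ) (K : Finset κ) (f g : κ → 𝔸) :
    holderSeminorm β adm dist (fun _ _ => id) K (f + g) ≤
      holderSeminorm β adm dist (fun _ _ => id) K f + holderSeminorm β adm dist (fun _ _ => id) K g := by
  refine holderSeminorm_le (add_nonneg (holderSeminorm_nonneg _ _ _ _ _ _) (holderSeminorm_nonneg _ _ _ _ _ _))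
    fun x hx x' hx' hadm hpos => ?_
  have hf := holder_bound (α := β) (adm := adm) (dist := dist) (τ := fun _ _ => id) (S := K) f hx hx' hadm hpos
  have hg := holder_bound (α := β) (adm := adm) (dist := dist) (τ := fun _ _ => id) (S := K) g hx hx' hadm hpos
  dsimp only [id] at hf hg ⊢
  calc ‖(f + g) x' - (f + g) x‖ = ‖(f x' - f x) + (g x' - g x)‖ := by
        simp only [Pi.add_apply]; abel_nf
    _ ≤ ‖f x' - f x‖ + ‖g x' - g x‖ := norm_add_le _ _
    _ ≤ holderSeminorm β adm dist (fun _ _ => id) K f * dist x x' ^ β +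
          holderSeminorm β adm dist (fun _ _ => id) K g * dist x x' ^ β := add_le_add hf hg
    _ = _ := by ring

/-- **Scalars**: `‖t•f‖_β ≤ ‖t‖·‖f‖_β`. [cite: Balaban1984PropagatorsI, (1.109) p.35] (elementary API; our proof) -/
theorem holderSeminorm_const_smul_le (β : ℝ) (adm : κ → κ → Prop) (dist : κ → κ → ℝ) (K : Finset κ) (t : 𝕜)
    (f : κ → 𝔸) :
    holderSeminorm β adm dist (fun _ _ => id) K (fun k => t • f k) ≤
      ‖t‖ * holderSeminorm β adm dist (fun _ _ => id) K f := by
  refine holderSeminorm_le (mul_nonneg (norm_nonneg _) (holderSeminorm_nonneg _ _ _ _ _ _))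
    fun x hx x' hx' hadm hpos => ?_
  have hf := holder_bound (α := β) (adm := adm) (dist := dist) (τ := fun _ _ => id) (S := K) f hx hx' hadm hpos
  dsimp only [id] at hf ⊢
  rw [← smul_sub, norm_smul, mul_assoc]
  exact mul_le_mul_of_nonneg_left hf (norm_nonneg _)

/-- **Products**: `‖a•G‖_β ≤ Φ·‖G‖_β + ‖a‖_β·n` when `|a| ≤ Φ` and `|G| ≤ n` on `K` — from
`a(x′)G(x′) − a(x)G(x) = a(x′)(G(x′) − G(x)) + (a(x′) − a(x))G(x)`.
[cite: Balaban1987RG1, (3.31) p.276] (our proof; the Hölder half of the Leibniz mechanism) -/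
theorem holderSeminorm_smul_le (β : ℝ) (adm : κ → κ → Prop) (dist : κ → κ → ℝ) (K : Finset κ) (a : κ → 𝕜)
    (G : κ → 𝔸) {Φ n : ℝ} (hΦ : 0 ≤ Φ) (hn : 0 ≤ n) (ha : ∀ k ∈ K, ‖a k‖ ≤ Φ) (hG : ∀ k ∈ K, ‖G k‖ ≤ n) :
    holderSeminorm β adm dist (fun _ _ => id) K (fun k => a k • G k) ≤
      Φ * holderSeminorm β adm dist (fun _ _ => id) K G + holderSeminorm β adm dist (fun _ _ => id) K a * n := by
  have hG0 := holderSeminorm_nonneg β adm dist (fun _ _ => (id : 𝔸 → 𝔸)) K G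
  have ha0 := holderSeminorm_nonneg β adm dist (fun _ _ => (id : 𝕜 → 𝕜)) K a
  refine holderSeminorm_le (add_nonneg (mul_nonneg hΦ hG0) (mul_nonneg ha0 hn)) fun x hx x' hx' hadm hpos => ?_
  have h1 := holder_bound (α := β) (adm := adm) (dist := dist) (τ := fun _ _ => id) (S := K) G hx hx' hadm hpos
  have h2 := holder_bound (α := β) (adm := adm) (dist := dist) (τ := fun _ _ => id) (S := K) a hx hx' hadm hpos
  dsimp only [id] at h1 h2 ⊢
  have hd : 0 ≤ dist x x' ^ β := (Real.rpow_pos_of_pos hpos β).le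
  calc ‖a x' • G x' - a x • G x‖ ≤ ‖a x'‖ * ‖G x' - G x‖ + ‖a x' - a x‖ * ‖G x‖ := norm_smul_sub_smul_le _ _ _ _
    _ ≤ Φ * (holderSeminorm β adm dist (fun _ _ => id) K G * dist x x' ^ β) +
          holderSeminorm β adm dist (fun _ _ => id) K a * dist x x' ^ β * n :=
        add_le_add (mul_le_mul (ha x' hx') h1 (norm_nonneg _) hΦ)
          (mul_le_mul h2 (hG x hx) (norm_nonneg _) (mul_nonneg ha0 hd))
    _ = _ := by ring

end Holder

/-! ## §4  The printed sentence: (3.31) for `𝐀 = (tζ̃_□ + t_□ζ_□)·F` -/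

section Cutoff

variable {ι κ : Type*} {𝕜 : Type*} [NormedField 𝕜] {𝔸 : Type*} [SeminormedAddCommGroup 𝔸] [NormedSpace 𝕜 𝔸]

/-- The cut-off multiplier `tζ̃_□ + t_□ζ_□` of (3.21)–(3.25)/(3.31), as a `𝕜`-valued bond function built from the values
`ζ̃ b`, `ζ b` of the two cut-offs at the bond `b` and the parameters `t` (interpolation, (3.21)) and `t□` (Cauchy
variable, (3.15)/(3.21)). [cite: Balaban1987RG1, (3.31) p.276] -/
def cutoff (t tb : 𝕜) (ζt ζ : ι → 𝕜) (b : ι) : 𝕜 := t * ζt b + tb * ζ b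

/-- Unfolding of `cutoff`. [cite: Balaban1987RG1, (3.31) p.276] -/
@[simp] theorem cutoff_apply (t tb : 𝕜) (ζt ζ : ι → 𝕜) (b : ι) : cutoff t tb ζt ζ b = t * ζt b + tb * ζ b := rfl

/-- `|tζ̃_□ + t_□ζ_□| ≤ 1 + r` when `|ζ̃|, |ζ| ≤ 1`, `|t| ≤ 1`, `|t_□| ≤ r`. [cite: Balaban1987RG1, (3.31) p.276] (our proof) -/
theorem norm_cutoff_le {t tb : 𝕜} {ζt ζ : ι → 𝕜} {r : ℝ} (hζt : ∀ b, ‖ζt b‖ ≤ 1) (hζ : ∀ b, ‖ζ b‖ ≤ 1)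
    (ht : ‖t‖ ≤ 1) (htb : ‖tb‖ ≤ r) (b : ι) : ‖cutoff t tb ζt ζ b‖ ≤ 1 + r := by
  rw [cutoff_apply]
  refine (norm_add_le _ _).trans ?_
  rw [norm_mul, norm_mul]
  have h1 : ‖t‖ * ‖ζt b‖ ≤ 1 := by
    calc ‖t‖ * ‖ζt b‖ ≤ 1 * 1 := mul_le_mul ht (hζt b) (norm_nonneg _) zero_le_one
      _ = 1 := one_mul 1
  have h2 : ‖tb‖ * ‖ζ b‖ ≤ r := by
    calc ‖tb‖ * ‖ζ b‖ ≤ r * 1 := mul_le_mul htb (hζ b) (norm_nonneg _) ((norm_nonneg _).trans htb)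
      _ = r := mul_one r
  exact add_le_add h1 h2

/-- The gradient of the cut-off multiplier is the same combination of the gradients of the two cut-offs:
`∇(tζ̃ + t_□ζ) = t∇ζ̃ + t_□∇ζ`. [cite: Balaban1987RG1, (3.31) p.276] (our proof) -/
theorem grad_cutoff (c : κ → 𝕜) (src tgt : κ → ι) (t tb : 𝕜) (ζt ζ : ι → 𝕜) (k : κ) :
    grad c src tgt (cutoff t tb ζt ζ) k = t * grad c src tgt ζt k + tb * grad c src tgt ζ k := by
  simp only [grad, cutoff_apply, smul_eq_mul]
  ring

/-- `|∇(tζ̃ + t_□ζ)| ≤ (1 + r)ℓ` when `|∇ζ̃|, |∇ζ| ≤ ℓ` at `k`. [cite: Balaban1987RG1, (3.31) p.276] (our proof) -/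
theorem norm_grad_cutoff_le (c : κ → 𝕜) (src tgt : κ → ι) {t tb : 𝕜} {ζt ζ : ι → 𝕜} {r ℓ : ℝ} (ht : ‖t‖ ≤ 1)
    (htb : ‖tb‖ ≤ r) {k : κ} (h1 : ‖grad c src tgt ζt k‖ ≤ ℓ) (h2 : ‖grad c src tgt ζ k‖ ≤ ℓ) :
    ‖grad c src tgt (cutoff t tb ζt ζ) k‖ ≤ (1 + r) * ℓ := by
  have hℓ : 0 ≤ ℓ := (norm_nonneg _).trans h1
  rw [grad_cutoff]
  refine (norm_add_le _ _).trans ?_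
  rw [norm_mul, norm_mul, add_mul, one_mul]
  exact add_le_add (by nlinarith [norm_nonneg t, norm_nonneg (grad c src tgt ζt k)])
    (mul_le_mul htb h2 (norm_nonneg _) ((norm_nonneg _).trans htb))

/-- Hölder data of the cut-off multiplier along `tgt`: `‖(tζ̃ + t_□ζ)∘tgt‖_β ≤ (1 + r)ℓ′` when
`‖ζ̃∘tgt‖_β, ‖ζ∘tgt‖_β ≤ ℓ′`. [cite: Balaban1987RG1, (3.31) p.276] (our proof) -/
theorem holderSeminorm_cutoff_tgt_le (β : ℝ) (adm : κ → κ → Prop) (dist : κ → κ → ℝ) (K : Finset κ) (tgt : κ → ι)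
    {t tb : 𝕜} {ζt ζ : ι → 𝕜} {r ℓ' : ℝ} (ht : ‖t‖ ≤ 1) (htb : ‖tb‖ ≤ r)
    (h1 : holderSeminorm β adm dist (fun _ _ => id) K (fun k => ζt (tgt k)) ≤ ℓ')
    (h2 : holderSeminorm β adm dist (fun _ _ => id) K (fun k => ζ (tgt k)) ≤ ℓ') :
    holderSeminorm β adm dist (fun _ _ => id) K (fun k => cutoff t tb ζt ζ (tgt k)) ≤ (1 + r) * ℓ' := by
  have hℓ' : 0 ≤ ℓ' := (holderSeminorm_nonneg _ _ _ _ _ _).trans h1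
  have hsplit : (fun k => cutoff t tb ζt ζ (tgt k)) =
      (fun k => t • (fun k => ζt (tgt k)) k) + fun k => tb • (fun k => ζ (tgt k)) k := by
    funext k; simp [cutoff_apply, smul_eq_mul]
  rw [hsplit]
  refine (holderSeminorm_add_le β adm dist K _ _).trans ?_
  have e1 := holderSeminorm_const_smul_le β adm dist K t (fun k => ζt (tgt k))
  have e2 := holderSeminorm_const_smul_le β adm dist K tb (fun k => ζ (tgt k))
  have f1 : ‖t‖ * holderSeminorm β adm dist (fun _ _ => id) K (fun k => ζt (tgt k)) ≤ 1 * ℓ' :=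
    mul_le_mul ht h1 (holderSeminorm_nonneg _ _ _ _ _ _) zero_le_one
  have f2 : ‖tb‖ * holderSeminorm β adm dist (fun _ _ => id) K (fun k => ζ (tgt k)) ≤ r * ℓ' :=
    mul_le_mul htb h2 (holderSeminorm_nonneg _ _ _ _ _ _) ((norm_nonneg _).trans htb)
  linarith

/-- Hölder data of the gradient of the cut-off multiplier: `‖∇(tζ̃ + t_□ζ)‖_β ≤ (1 + r)ℓ″` when
`‖∇ζ̃‖_β, ‖∇ζ‖_β ≤ ℓ″`. [cite: Balaban1987RG1, (3.31) p.276] (our proof) -/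
theorem holderSeminorm_grad_cutoff_le (β : ℝ) (adm : κ → κ → Prop) (dist : κ → κ → ℝ) (K : Finset κ) (c : κ → 𝕜)
    (src tgt : κ → ι) {t tb : 𝕜} {ζt ζ : ι → 𝕜} {r ℓ'' : ℝ} (ht : ‖t‖ ≤ 1) (htb : ‖tb‖ ≤ r)
    (h1 : holderSeminorm β adm dist (fun _ _ => id) K (grad c src tgt ζt) ≤ ℓ'')
    (h2 : holderSeminorm β adm dist (fun _ _ => id) K (grad c src tgt ζ) ≤ ℓ'') :
    holderSeminorm β adm dist (fun _ _ => id) K (grad c src tgt (cutoff t tb ζt ζ)) ≤ (1 + r) * ℓ'' := by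
  have hℓ'' : 0 ≤ ℓ'' := (holderSeminorm_nonneg _ _ _ _ _ _).trans h1
  have hsplit : grad c src tgt (cutoff t tb ζt ζ) =
      (fun k => t • grad c src tgt ζt k) + fun k => tb • grad c src tgt ζ k := by
    funext k; simp only [grad_cutoff, Pi.add_apply, smul_eq_mul]
  rw [hsplit]
  refine (holderSeminorm_add_le β adm dist K _ _).trans ?_
  have e1 := holderSeminorm_const_smul_le β adm dist K t (grad c src tgt ζt)
  have e2 := holderSeminorm_const_smul_le β adm dist K tb (grad c src tgt ζ)
  have f1 : ‖t‖ * holderSeminorm β adm dist (fun _ _ => id) K (grad c src tgt ζt) ≤ 1 * ℓ'' :=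
    mul_le_mul ht h1 (holderSeminorm_nonneg _ _ _ _ _ _) zero_le_one
  have f2 : ‖tb‖ * holderSeminorm β adm dist (fun _ _ => id) K (grad c src tgt ζ) ≤ r * ℓ'' :=
    mul_le_mul htb h2 (holderSeminorm_nonneg _ _ _ _ _ _) ((norm_nonneg _).trans htb)
  linarith

/-- **(3.31), first member, for the cut-off field**: `|(tζ̃_□ + t_□ζ_□)F| ≤ (1 + r)·n₀` on `S` when `|F| ≤ n₀`.
[cite: Balaban1987RG1, (3.31) p.276] -/
theorem norm331_sup_le (S : Finset ι) {t tb : 𝕜} {ζt ζ : ι → 𝕜} (F : ι → 𝔸) {r n₀ : ℝ}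
    (hζt : ∀ b, ‖ζt b‖ ≤ 1) (hζ : ∀ b, ‖ζ b‖ ≤ 1) (ht : ‖t‖ ≤ 1) (htb : ‖tb‖ ≤ r) (hn₀ : 0 ≤ n₀)
    (hF₀ : ∀ b, ‖F b‖ ≤ n₀) :
    supNorm S (fun b => cutoff t tb ζt ζ b • F b) ≤ (1 + r) * n₀ :=
  supNorm_smul_le S _ F (by linarith [(norm_nonneg tb).trans htb]) hn₀
    (fun b _ => norm_cutoff_le hζt hζ ht htb b) fun b _ => hF₀ b

/-- **(3.31), second member, for the cut-off field**: `|∇((tζ̃_□ + t_□ζ_□)F)| ≤ (1 + r)(n₁ + ℓn₀)` on `K` when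
`|F| ≤ n₀`, `|∇F| ≤ n₁` on `K` and the cut-off gradients are `≤ ℓ` on `K`. [cite: Balaban1987RG1, (3.31) p.276] -/
theorem norm331_grad_le (K : Finset κ) (c : κ → 𝕜) (src tgt : κ → ι) {t tb : 𝕜} {ζt ζ : ι → 𝕜} (F : ι → 𝔸)
    {r ℓ n₀ n₁ : ℝ} (hζt : ∀ b, ‖ζt b‖ ≤ 1) (hζ : ∀ b, ‖ζ b‖ ≤ 1) (ht : ‖t‖ ≤ 1) (htb : ‖tb‖ ≤ r) (hℓ : 0 ≤ ℓ)
    (hn₀ : 0 ≤ n₀) (hn₁ : 0 ≤ n₁)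
    (hdζ : ∀ k ∈ K, ‖grad c src tgt ζt k‖ ≤ ℓ ∧ ‖grad c src tgt ζ k‖ ≤ ℓ)
    (hF₀ : ∀ b, ‖F b‖ ≤ n₀) (hF₁ : ∀ k ∈ K, ‖grad c src tgt F k‖ ≤ n₁) :
    supNorm K (grad c src tgt (fun b => cutoff t tb ζt ζ b • F b)) ≤ (1 + r) * (n₁ + ℓ * n₀) := by
  have hr : 0 ≤ 1 + r := by linarith [(norm_nonneg tb).trans htb]
  have h := supNorm_grad_smul_le K c src tgt (cutoff t tb ζt ζ) F hr (mul_nonneg hr hℓ) hn₀ hn₁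
    (fun k _ => norm_cutoff_le hζt hζ ht htb (tgt k))
    (fun k hk => norm_grad_cutoff_le c src tgt ht htb (hdζ k hk).1 (hdζ k hk).2)
    (fun k _ => hF₀ (src k)) hF₁
  calc _ ≤ (1 + r) * n₁ + (1 + r) * ℓ * n₀ := h
    _ = (1 + r) * (n₁ + ℓ * n₀) := by ring

/-- **(3.31), third member, for the cut-off field**: the Hölder seminorm of the gradient of `(tζ̃_□ + t_□ζ_□)F` over `K`
is `≤ (1 + r)(n₂ + ℓ′n₁ + ℓn₃ + ℓ″n₀)` when `|F| ≤ n₀`, `|∇F| ≤ n₁`, `‖∇F‖_β ≤ n₂`, `‖F∘src‖_β ≤ n₃` and the cut-off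
data are `≤ ℓ` (gradients), `≤ ℓ′` (Hölder, values along `tgt`), `≤ ℓ″` (Hölder, gradients).
[cite: Balaban1987RG1, (3.31) p.276] -/
theorem norm331_holder_le (β : ℝ) (adm : κ → κ → Prop) (dist : κ → κ → ℝ) (K : Finset κ) (c : κ → 𝕜)
    (src tgt : κ → ι) {t tb : 𝕜} {ζt ζ : ι → 𝕜} (F : ι → 𝔸) {r ℓ ℓ' ℓ'' n₀ n₁ n₂ n₃ : ℝ}
    (hζt : ∀ b, ‖ζt b‖ ≤ 1) (hζ : ∀ b, ‖ζ b‖ ≤ 1) (ht : ‖t‖ ≤ 1) (htb : ‖tb‖ ≤ r) (hℓ : 0 ≤ ℓ)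
    (hn₀ : 0 ≤ n₀) (hn₁ : 0 ≤ n₁)
    (hdζ : ∀ k ∈ K, ‖grad c src tgt ζt k‖ ≤ ℓ ∧ ‖grad c src tgt ζ k‖ ≤ ℓ)
    (hhζt : holderSeminorm β adm dist (fun _ _ => id) K (fun k => ζt (tgt k)) ≤ ℓ')
    (hhζ : holderSeminorm β adm dist (fun _ _ => id) K (fun k => ζ (tgt k)) ≤ ℓ')
    (hhdζt : holderSeminorm β adm dist (fun _ _ => id) K (grad c src tgt ζt) ≤ ℓ'')
    (hhdζ : holderSeminorm β adm dist (fun _ _ => id) K (grad c src tgt ζ) ≤ ℓ'')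
    (hF₀ : ∀ b, ‖F b‖ ≤ n₀) (hF₁ : ∀ k ∈ K, ‖grad c src tgt F k‖ ≤ n₁)
    (hF₂ : holderSeminorm β adm dist (fun _ _ => id) K (grad c src tgt F) ≤ n₂)
    (hF₃ : holderSeminorm β adm dist (fun _ _ => id) K (fun k => F (src k)) ≤ n₃) :
    holderSeminorm β adm dist (fun _ _ => id) K (grad c src tgt (fun b => cutoff t tb ζt ζ b • F b)) ≤
      (1 + r) * (n₂ + ℓ' * n₁ + ℓ * n₃ + ℓ'' * n₀) := by
  have hr : 0 ≤ 1 + r := by linarith [(norm_nonneg tb).trans htb]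
  have hℓ' : 0 ≤ ℓ' := (holderSeminorm_nonneg _ _ _ _ _ _).trans hhζt
  have hn₂ : 0 ≤ n₂ := (holderSeminorm_nonneg _ _ _ _ _ _).trans hF₂
  have hn₃ : 0 ≤ n₃ := (holderSeminorm_nonneg _ _ _ _ _ _).trans hF₃
  rw [grad_smul_eq]
  refine (holderSeminorm_add_le β adm dist K _ _).trans ?_
  -- first summand: (φ∘tgt)•∇F
  have A := holderSeminorm_smul_le β adm dist K (fun k => cutoff t tb ζt ζ (tgt k)) (grad c src tgt F) hr hn₁
    (fun k _ => norm_cutoff_le hζt hζ ht htb (tgt k)) hF₁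
  have A' := holderSeminorm_cutoff_tgt_le β adm dist K tgt ht htb hhζt hhζ
  -- second summand: ∇φ • (F∘src)
  have B := holderSeminorm_smul_le β adm dist K (grad c src tgt (cutoff t tb ζt ζ)) (fun k => F (src k))
    (mul_nonneg hr hℓ) hn₀ (fun k hk => norm_grad_cutoff_le c src tgt ht htb (hdζ k hk).1 (hdζ k hk).2)
    (fun k _ => hF₀ (src k))
  have B' := holderSeminorm_grad_cutoff_le β adm dist K c src tgt ht htb hhdζt hhdζ
  have hG0 := holderSeminorm_nonneg β adm dist (fun _ _ => (id : 𝔸 → 𝔸)) K (grad c src tgt F)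
  calc holderSeminorm β adm dist (fun _ _ => id) K (fun k => cutoff t tb ζt ζ (tgt k) • grad c src tgt F k) +
        holderSeminorm β adm dist (fun _ _ => id) K (fun k => grad c src tgt (cutoff t tb ζt ζ) k • F (src k))
      ≤ ((1 + r) * holderSeminorm β adm dist (fun _ _ => id) K (grad c src tgt F) +
          holderSeminorm β adm dist (fun _ _ => id) K (fun k => cutoff t tb ζt ζ (tgt k)) * n₁) +
        ((1 + r) * ℓ * holderSeminorm β adm dist (fun _ _ => id) K (fun k => F (src k)) +
          holderSeminorm β adm dist (fun _ _ => id) K (grad c src tgt (cutoff t tb ζt ζ)) * n₀) := add_le_add A B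
    _ ≤ ((1 + r) * n₂ + (1 + r) * ℓ' * n₁) + ((1 + r) * ℓ * n₃ + (1 + r) * ℓ'' * n₀) := by
        gcongr
    _ = (1 + r) * (n₂ + ℓ' * n₁ + ℓ * n₃ + ℓ'' * n₀) := by ring

/-- **The printed sentence** *«Obviously such bounds are satisfied by the function (tζ̃_□ + t_□ζ_□)𝐇_k(B′) for ε₁
sufficiently small»*, threshold explicit: if the displayed inputs for `F = 𝐇_k(B′)` are LINEAR in `ε₁` — `|F| ≤ Cε₁`,
`|∇F| ≤ Cε₁`, `‖∇F‖_β ≤ Cε₁`, `‖F∘src‖_β ≤ Cε₁` (the (3.9)/[15] (190) shape combined with `|B′| < ε₁` of (2.9)) — and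
`(1 + r)(1 + ℓ + ℓ′ + ℓ″)·C·ε₁ < α₂`, then all three members of (3.31) hold for `𝐀 = (tζ̃_□ + t_□ζ_□)F`:
`|𝐀| < α₂` on `S`, `|∇𝐀| < α₂` and `‖𝐀‖_{1,β} = ‖∇𝐀‖_β < α₂` on `K`. [cite: Balaban1987RG1, (3.31) p.276] -/
theorem ineq331_cutoff_of_small (S : Finset ι) (β : ℝ) (adm : κ → κ → Prop) (dist : κ → κ → ℝ) (K : Finset κ)
    (c : κ → 𝕜) (src tgt : κ → ι) {t tb : 𝕜} {ζt ζ : ι → 𝕜} (F : ι → 𝔸) {r ℓ ℓ' ℓ'' C ε₁ α₂ : ℝ}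
    (hζt : ∀ b, ‖ζt b‖ ≤ 1) (hζ : ∀ b, ‖ζ b‖ ≤ 1) (ht : ‖t‖ ≤ 1) (htb : ‖tb‖ ≤ r) (hℓ : 0 ≤ ℓ) (hℓ'' : 0 ≤ ℓ'')
    (hdζ : ∀ k ∈ K, ‖grad c src tgt ζt k‖ ≤ ℓ ∧ ‖grad c src tgt ζ k‖ ≤ ℓ)
    (hhζt : holderSeminorm β adm dist (fun _ _ => id) K (fun k => ζt (tgt k)) ≤ ℓ')
    (hhζ : holderSeminorm β adm dist (fun _ _ => id) K (fun k => ζ (tgt k)) ≤ ℓ')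
    (hhdζt : holderSeminorm β adm dist (fun _ _ => id) K (grad c src tgt ζt) ≤ ℓ'')
    (hhdζ : holderSeminorm β adm dist (fun _ _ => id) K (grad c src tgt ζ) ≤ ℓ'')
    (hF₀ : ∀ b, ‖F b‖ ≤ C * ε₁) (hF₁ : ∀ k ∈ K, ‖grad c src tgt F k‖ ≤ C * ε₁)
    (hF₂ : holderSeminorm β adm dist (fun _ _ => id) K (grad c src tgt F) ≤ C * ε₁)
    (hF₃ : holderSeminorm β adm dist (fun _ _ => id) K (fun k => F (src k)) ≤ C * ε₁)
    (hsmall : (1 + r) * (1 + ℓ + ℓ' + ℓ'') * C * ε₁ < α₂) :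
    supNorm S (fun b => cutoff t tb ζt ζ b • F b) < α₂ ∧
      supNorm K (grad c src tgt (fun b => cutoff t tb ζt ζ b • F b)) < α₂ ∧
        holderSeminorm β adm dist (fun _ _ => id) K (grad c src tgt (fun b => cutoff t tb ζt ζ b • F b)) < α₂ := by
  have hr : 0 ≤ 1 + r := by linarith [(norm_nonneg tb).trans htb]
  have hℓ' : 0 ≤ ℓ' := (holderSeminorm_nonneg _ _ _ _ _ _).trans hhζt
  have hCε : 0 ≤ C * ε₁ := (holderSeminorm_nonneg _ _ _ _ _ _).trans hF₂
  have h1 := norm331_sup_le S F hζt hζ ht htb hCε hF₀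
  have h2 := norm331_grad_le K c src tgt F hζt hζ ht htb hℓ hCε hCε hdζ hF₀ hF₁
  have h3 := norm331_holder_le β adm dist K c src tgt F hζt hζ ht htb hℓ hCε hCε hdζ hhζt hhζ hhdζt hhdζ hF₀ hF₁
    hF₂ hF₃
  have e1 : (1 + r) * (C * ε₁) ≤ (1 + r) * (1 + ℓ + ℓ' + ℓ'') * C * ε₁ := by
    have : (1 + r) * (C * ε₁) * 1 ≤ (1 + r) * (C * ε₁) * (1 + ℓ + ℓ' + ℓ'') :=
      mul_le_mul_of_nonneg_left (by linarith) (mul_nonneg hr hCε)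
    linarith
  have e2 : (1 + r) * (C * ε₁ + ℓ * (C * ε₁)) ≤ (1 + r) * (1 + ℓ + ℓ' + ℓ'') * C * ε₁ := by
    have : (1 + r) * (C * ε₁) * (1 + ℓ) ≤ (1 + r) * (C * ε₁) * (1 + ℓ + ℓ' + ℓ'') :=
      mul_le_mul_of_nonneg_left (by linarith) (mul_nonneg hr hCε)
    linarith
  have e3 : (1 + r) * (C * ε₁ + ℓ' * (C * ε₁) + ℓ * (C * ε₁) + ℓ'' * (C * ε₁)) =
      (1 + r) * (1 + ℓ + ℓ' + ℓ'') * C * ε₁ := by ring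
  exact ⟨by linarith, by linarith, by linarith⟩

end Cutoff

/-! ## §5  The printed cut-off `ζ_□(x) = Π_μ ζ(M⁻¹(x_μ − y_μ))` of p. 270: its regularity inputs -/

section Cube

open Finset

variable {d : ℕ}

/-- The PRODUCT CUT-OFF of p. 270 for a general one-variable profile `ζ`: `ζ_□(x) = Π_μ ζ(M⁻¹(x_μ − y_μ))`, `y` the
centre of the cube `□`, `M` its scale. [cite: Balaban1987RG1, §3 p.270] -/
noncomputable def cubeCutoff (ζ : ℝ → ℝ) (M : ℝ) (y x : Fin d → ℝ) : ℝ := ∏ μ, ζ (M⁻¹ * (x μ - y μ))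

/-- For the constructed profile of `B12PartitionUnity270` the product cut-off IS `zetaCube` (same formula).
[cite: Balaban1987RG1, §3 p.270] -/
theorem cubeCutoff_zeta (M : ℝ) (y x : Fin d → ℝ) :
    cubeCutoff B12PartitionUnity270.zeta M y x = B12PartitionUnity270.zetaCube d M y x := rfl

/-- The `ℓ¹` distance of two points, `|x − x′| = Σ_μ |x_μ − x′_μ|` (the series' convention, B6 p. 223).
[cite: Balaban1984PropagatorsII, p.223] -/
def l1 (x x' : Fin d → ℝ) : ℝ := ∑ μ, |x μ - x' μ|

/-- `|x − x′| ≥ 0`. [cite: Balaban1984PropagatorsII, p.223] -/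
theorem l1_nonneg (x x' : Fin d → ℝ) : 0 ≤ l1 x x' := sum_nonneg fun _ _ => abs_nonneg _

/-- `|x − x′| = |x′ − x|`. [cite: Balaban1984PropagatorsII, p.223] -/
theorem l1_comm (x x' : Fin d → ℝ) : l1 x x' = l1 x' x := by
  unfold l1; exact sum_congr rfl fun μ _ => abs_sub_comm _ _

/-- One coordinate difference is bounded by the `ℓ¹` distance. [cite: Balaban1984PropagatorsII, p.223] -/
theorem abs_sub_le_l1 (x x' : Fin d → ℝ) (ν : Fin d) : |x ν - x' ν| ≤ l1 x x' :=
  single_le_sum (f := fun μ => |x μ - x' μ|) (fun _ _ => abs_nonneg _) (mem_univ ν)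

/-- The shifted point `x + ηe_ν`. [cite: Balaban1987RG1, (3.31) p.276] -/
def shiftPt (x : Fin d → ℝ) (ν : Fin d) (η : ℝ) : Fin d → ℝ := x + Pi.single ν η

/-- `(x + ηe_ν)_ν = x_ν + η`. [cite: Balaban1987RG1, (3.31) p.276] -/
@[simp] theorem shiftPt_apply_self (x : Fin d → ℝ) (ν : Fin d) (η : ℝ) : shiftPt x ν η ν = x ν + η := by
  simp [shiftPt]

/-- `(x + ηe_ν)_μ = x_μ` for `μ ≠ ν`. [cite: Balaban1987RG1, (3.31) p.276] -/
theorem shiftPt_apply_ne (x : Fin d → ℝ) {ν μ : Fin d} (η : ℝ) (h : μ ≠ ν) : shiftPt x ν η μ = x μ := by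
  simp [shiftPt, Pi.single_eq_of_ne h]

/-- A common shift does not change the `ℓ¹` distance. [cite: Balaban1984PropagatorsII, p.223] -/
theorem l1_shiftPt_shiftPt (x x' : Fin d → ℝ) (ν : Fin d) (η : ℝ) :
    l1 (shiftPt x ν η) (shiftPt x' ν η) = l1 x x' := by
  unfold l1
  refine sum_congr rfl fun μ _ => ?_
  by_cases h : μ = ν
  · subst h; simp
  · rw [shiftPt_apply_ne x η h, shiftPt_apply_ne x' η h]

/-- `|x + ηe_ν − x| = |η|`. [cite: Balaban1984PropagatorsII, p.223] -/
theorem l1_shiftPt_self (x : Fin d → ℝ) (ν : Fin d) (η : ℝ) : l1 (shiftPt x ν η) x = |η| := by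
  unfold l1
  rw [sum_eq_single ν]
  · simp
  · intro μ _ hμ; rw [shiftPt_apply_ne x η hμ, sub_self, abs_zero]
  · intro h; exact absurd (mem_univ ν) h

/-- `0 ≤ ζ_□ ≤ 1`, hence `|ζ_□| ≤ 1`, for a profile with values in `[0, 1]`. [cite: Balaban1987RG1, §3 p.270] -/
theorem abs_cubeCutoff_le_one {ζ : ℝ → ℝ} (h01 : ∀ s, 0 ≤ ζ s ∧ ζ s ≤ 1) (M : ℝ) (y x : Fin d → ℝ) :
    |cubeCutoff ζ M y x| ≤ 1 := by
  unfold cubeCutoff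
  rw [abs_of_nonneg (prod_nonneg fun μ _ => (h01 _).1)]
  exact prod_le_one (fun μ _ => (h01 _).1) fun μ _ => (h01 _).2

/-- **`ζ_□` is `ℓ¹`-Lipschitz with constant `M⁻¹D`**: `|ζ_□(x) − ζ_□(x′)| ≤ M⁻¹D Σ_μ |x_μ − x′_μ|` for a `D`-Lipschitz
profile with values in `[0, 1]` (telescoping the product, `|Πa − Πb| ≤ Σ|a − b|` for factors in `[0, 1]`,
`Literature.Analysis.FunctionSpaces.abs_prod_sub_prod_le_sum` BY NAME). [cite: Balaban1987RG1, §3 p.270] (our proof) -/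
theorem abs_cubeCutoff_sub_le {ζ : ℝ → ℝ} {D M : ℝ} (h01 : ∀ s, 0 ≤ ζ s ∧ ζ s ≤ 1)
    (hLip : ∀ s s', |ζ s - ζ s'| ≤ D * |s - s'|) (hM : 0 < M) (y x x' : Fin d → ℝ) :
    |cubeCutoff ζ M y x - cubeCutoff ζ M y x'| ≤ M⁻¹ * D * l1 x x' := by
  unfold cubeCutoff l1
  refine (Literature.Analysis.FunctionSpaces.abs_prod_sub_prod_le_sum _ (fun μ _ => (h01 _).1)
    (fun μ _ => (h01 _).2) (fun μ _ => (h01 _).1) (fun μ _ => (h01 _).2)).trans ?_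
  rw [mul_sum]
  refine sum_le_sum fun μ _ => ?_
  have hid : M⁻¹ * (x μ - y μ) - M⁻¹ * (x' μ - y μ) = M⁻¹ * (x μ - x' μ) := by ring
  calc |ζ (M⁻¹ * (x μ - y μ)) - ζ (M⁻¹ * (x' μ - y μ))| ≤ D * |M⁻¹ * (x μ - y μ) - M⁻¹ * (x' μ - y μ)| :=
        hLip _ _
    _ = M⁻¹ * D * |x μ - x' μ| := by rw [hid, abs_mul, abs_of_pos (inv_pos.2 hM)]; ring

/-- Hölder form of the previous bound: for pairs at `ℓ¹`-distance `0 < |x − x′| ≤ 1` and `0 ≤ β ≤ 1`,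
`|ζ_□(x) − ζ_□(x′)| ≤ M⁻¹D |x − x′|^β` (since `u ≤ u^β` for `u ∈ ]0, 1]`). [cite: Balaban1987RG1, §3 p.270] (our proof) -/
theorem abs_cubeCutoff_sub_le_rpow {ζ : ℝ → ℝ} {D M β : ℝ} (h01 : ∀ s, 0 ≤ ζ s ∧ ζ s ≤ 1)
    (hLip : ∀ s s', |ζ s - ζ s'| ≤ D * |s - s'|) (hM : 0 < M) (hD : 0 ≤ D) (hβ1 : β ≤ 1) (y x x' : Fin d → ℝ)
    (hpos : 0 < l1 x x') (hle : l1 x x' ≤ 1) :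
    |cubeCutoff ζ M y x - cubeCutoff ζ M y x'| ≤ M⁻¹ * D * l1 x x' ^ β := by
  refine (abs_cubeCutoff_sub_le h01 hLip hM y x x').trans (mul_le_mul_of_nonneg_left ?_ ?_)
  · simpa using Real.rpow_le_rpow_of_exponent_ge hpos hle hβ1
  · exact mul_nonneg (inv_pos.2 hM).le hD

/-- The lattice gradient of the cut-off in direction `ν` with spacing `η`: `(∇_νζ_□)(x) = η⁻¹(ζ_□(x + ηe_ν) − ζ_□(x))`.
[cite: Balaban1987RG1, (3.31) p.276] -/
noncomputable def gradCube (ζ : ℝ → ℝ) (M : ℝ) (y : Fin d → ℝ) (ν : Fin d) (η : ℝ) (x : Fin d → ℝ) : ℝ :=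
  η⁻¹ * (cubeCutoff ζ M y (shiftPt x ν η) - cubeCutoff ζ M y x)

/-- **`|∇^ηζ_□| ≤ M⁻¹D`** (from the Lipschitz bound, `|x + ηe_ν − x| = η`). [cite: Balaban1987RG1, (3.31) p.276] (our proof) -/
theorem abs_gradCube_le {ζ : ℝ → ℝ} {D M : ℝ} (h01 : ∀ s, 0 ≤ ζ s ∧ ζ s ≤ 1)
    (hLip : ∀ s s', |ζ s - ζ s'| ≤ D * |s - s'|) (hM : 0 < M) {η : ℝ} (hη : η ≠ 0) (y : Fin d → ℝ) (ν : Fin d)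
    (x : Fin d → ℝ) : |gradCube ζ M y ν η x| ≤ M⁻¹ * D := by
  unfold gradCube
  rw [abs_mul, abs_inv]
  have h := abs_cubeCutoff_sub_le h01 hLip hM y (shiftPt x ν η) x
  rw [l1_shiftPt_self] at h
  have hη' : 0 < |η| := abs_pos.2 hη
  calc |η|⁻¹ * |cubeCutoff ζ M y (shiftPt x ν η) - cubeCutoff ζ M y x| ≤ |η|⁻¹ * (M⁻¹ * D * |η|) :=
        mul_le_mul_of_nonneg_left h (inv_nonneg.2 hη'.le)
    _ = M⁻¹ * D := by field_simp

/-- The one-variable difference quotient `w(s) = η⁻¹(ζ(M⁻¹(s + η − y₀)) − ζ(M⁻¹(s − y₀)))` of the profile along one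
axis. [cite: Balaban1987RG1, (3.31) p.276] (auxiliary; our notation) -/
noncomputable def axisQuot (ζ : ℝ → ℝ) (M y₀ η s : ℝ) : ℝ :=
  η⁻¹ * (ζ (M⁻¹ * (s + η - y₀)) - ζ (M⁻¹ * (s - y₀)))

/-- The product of the remaining factors, `P_ν(x) = Π_{μ ≠ ν} ζ(M⁻¹(x_μ − y_μ))`. [cite: Balaban1987RG1, §3 p.270]
(auxiliary; our notation) -/
noncomputable def perpProd (ζ : ℝ → ℝ) (M : ℝ) (y : Fin d → ℝ) (ν : Fin d) (x : Fin d → ℝ) : ℝ :=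
  ∏ μ ∈ univ.erase ν, ζ (M⁻¹ * (x μ - y μ))

/-- Factorization `ζ_□(x) = ζ(M⁻¹(x_ν − y_ν))·P_ν(x)`. [cite: Balaban1987RG1, §3 p.270] (our proof) -/
theorem cubeCutoff_eq_mul_perpProd (ζ : ℝ → ℝ) (M : ℝ) (y : Fin d → ℝ) (ν : Fin d) (x : Fin d → ℝ) :
    cubeCutoff ζ M y x = ζ (M⁻¹ * (x ν - y ν)) * perpProd ζ M y ν x := by
  unfold cubeCutoff perpProd
  exact (mul_prod_erase univ (fun μ => ζ (M⁻¹ * (x μ - y μ))) (mem_univ ν)).symm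

/-- `P_ν` does not see the `ν`-th coordinate: `P_ν(x + ηe_ν) = P_ν(x)`. [cite: Balaban1987RG1, §3 p.270] (our proof) -/
theorem perpProd_shiftPt (ζ : ℝ → ℝ) (M : ℝ) (y : Fin d → ℝ) (ν : Fin d) (η : ℝ) (x : Fin d → ℝ) :
    perpProd ζ M y ν (shiftPt x ν η) = perpProd ζ M y ν x := by
  unfold perpProd
  exact prod_congr rfl fun μ hμ => by rw [shiftPt_apply_ne x η (ne_of_mem_erase hμ)]

/-- **Factorization of the lattice gradient of the cut-off**: `(∇_νζ_□)(x) = w(x_ν)·P_ν(x)`.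
[cite: Balaban1987RG1, (3.31) p.276] (our proof) -/
theorem gradCube_eq (ζ : ℝ → ℝ) (M : ℝ) (y : Fin d → ℝ) (ν : Fin d) (η : ℝ) (x : Fin d → ℝ) :
    gradCube ζ M y ν η x = axisQuot ζ M (y ν) η (x ν) * perpProd ζ M y ν x := by
  unfold gradCube axisQuot
  rw [cubeCutoff_eq_mul_perpProd ζ M y ν (shiftPt x ν η), cubeCutoff_eq_mul_perpProd ζ M y ν x, perpProd_shiftPt,
    shiftPt_apply_self]
  ring

/-- `|P_ν| ≤ 1`. [cite: Balaban1987RG1, §3 p.270] (our proof) -/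
theorem abs_perpProd_le_one {ζ : ℝ → ℝ} (h01 : ∀ s, 0 ≤ ζ s ∧ ζ s ≤ 1) (M : ℝ) (y : Fin d → ℝ) (ν : Fin d)
    (x : Fin d → ℝ) : |perpProd ζ M y ν x| ≤ 1 := by
  unfold perpProd
  rw [abs_of_nonneg (prod_nonneg fun μ _ => (h01 _).1)]
  exact prod_le_one (fun μ _ => (h01 _).1) fun μ _ => (h01 _).2

/-- `P_ν` is `ℓ¹`-Lipschitz with constant `M⁻¹D`. [cite: Balaban1987RG1, §3 p.270] (our proof) -/
theorem abs_perpProd_sub_le {ζ : ℝ → ℝ} {D M : ℝ} (h01 : ∀ s, 0 ≤ ζ s ∧ ζ s ≤ 1)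
    (hLip : ∀ s s', |ζ s - ζ s'| ≤ D * |s - s'|) (hM : 0 < M) (hD : 0 ≤ D) (y : Fin d → ℝ) (ν : Fin d)
    (x x' : Fin d → ℝ) : |perpProd ζ M y ν x - perpProd ζ M y ν x'| ≤ M⁻¹ * D * l1 x x' := by
  unfold perpProd
  refine (Literature.Analysis.FunctionSpaces.abs_prod_sub_prod_le_sum _ (fun μ _ => (h01 _).1)
    (fun μ _ => (h01 _).2) (fun μ _ => (h01 _).1) (fun μ _ => (h01 _).2)).trans ?_
  have hid : ∀ μ, M⁻¹ * (x μ - y μ) - M⁻¹ * (x' μ - y μ) = M⁻¹ * (x μ - x' μ) := fun μ => by ring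
  calc ∑ μ ∈ univ.erase ν, |ζ (M⁻¹ * (x μ - y μ)) - ζ (M⁻¹ * (x' μ - y μ))|
      ≤ ∑ μ ∈ univ.erase ν, M⁻¹ * D * |x μ - x' μ| := sum_le_sum fun μ _ => by
        calc |ζ (M⁻¹ * (x μ - y μ)) - ζ (M⁻¹ * (x' μ - y μ))| ≤ D * |M⁻¹ * (x μ - y μ) - M⁻¹ * (x' μ - y μ)| :=
            hLip _ _
          _ = M⁻¹ * D * |x μ - x' μ| := by rw [hid, abs_mul, abs_of_pos (inv_pos.2 hM)]; ring
    _ ≤ ∑ μ, M⁻¹ * D * |x μ - x' μ| :=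
        sum_le_sum_of_subset_of_nonneg (erase_subset _ _) fun μ _ _ =>
          mul_nonneg (mul_nonneg (inv_pos.2 hM).le hD) (abs_nonneg _)
    _ = M⁻¹ * D * l1 x x' := by rw [l1, mul_sum]

/-- `|w(s)| ≤ M⁻¹D` (the profile is `D`-Lipschitz). [cite: Balaban1987RG1, (3.31) p.276] (our proof) -/
theorem abs_axisQuot_le {ζ : ℝ → ℝ} {D M : ℝ} (hLip : ∀ s s', |ζ s - ζ s'| ≤ D * |s - s'|) (hM : 0 < M)
    {η : ℝ} (hη : η ≠ 0) (y₀ s : ℝ) : |axisQuot ζ M y₀ η s| ≤ M⁻¹ * D := by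
  unfold axisQuot
  have hη' : 0 < |η| := abs_pos.2 hη
  have hid : M⁻¹ * (s + η - y₀) - M⁻¹ * (s - y₀) = M⁻¹ * η := by ring
  rw [abs_mul, abs_inv]
  calc |η|⁻¹ * |ζ (M⁻¹ * (s + η - y₀)) - ζ (M⁻¹ * (s - y₀))| ≤ |η|⁻¹ * (D * |M⁻¹ * (s + η - y₀) - M⁻¹ * (s - y₀)|) :=
        mul_le_mul_of_nonneg_left (hLip _ _) (inv_nonneg.2 hη'.le)
    _ = M⁻¹ * D := by rw [hid, abs_mul, abs_of_pos (inv_pos.2 hM)]; field_simp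

/-- **`w` is Lipschitz with constant `M⁻²D₂`** when `ζ′` is `D₂`-Lipschitz: the second difference of `ζ` is controlled
by the mean value inequality applied to `θ ↦ ζ(M⁻¹(s + θ − y₀)) − ζ(M⁻¹(s′ + θ − y₀))` on `[0, η]`.
[cite: Balaban1987RG1, (3.31) p.276] (our proof) -/
theorem abs_axisQuot_sub_le {ζ ζ' : ℝ → ℝ} {D₂ M : ℝ} (hder : ∀ s, HasDerivAt ζ (ζ' s) s)
    (hLip' : ∀ s s', |ζ' s - ζ' s'| ≤ D₂ * |s - s'|) (hM : 0 < M) {η : ℝ} (hη : η ≠ 0) (y₀ s s' : ℝ) :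
    |axisQuot ζ M y₀ η s - axisQuot ζ M y₀ η s'| ≤ M⁻¹ ^ 2 * D₂ * |s - s'| := by
  -- the auxiliary function `r(θ) = ζ(M⁻¹(s + θ − y₀)) − ζ(M⁻¹(s′ + θ − y₀))` and its derivative
  have ha : ∀ a θ : ℝ, HasDerivAt (fun θ : ℝ => M⁻¹ * (a + θ - y₀)) M⁻¹ θ := by
    intro a θ
    have h1 : HasDerivAt (fun θ : ℝ => a + θ - y₀) 1 θ := by
      simpa using ((hasDerivAt_id θ).const_add a).sub_const y₀
    simpa using h1.const_mul M⁻¹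
  have hr' : ∀ θ, HasDerivAt (fun θ : ℝ => ζ (M⁻¹ * (s + θ - y₀)) - ζ (M⁻¹ * (s' + θ - y₀)))
      (M⁻¹ * ζ' (M⁻¹ * (s + θ - y₀)) - M⁻¹ * ζ' (M⁻¹ * (s' + θ - y₀))) θ := by
    intro θ
    have h1 := (hder (M⁻¹ * (s + θ - y₀))).comp θ (ha s θ)
    have h2 := (hder (M⁻¹ * (s' + θ - y₀))).comp θ (ha s' θ)
    have h3 := h1.sub h2
    simp only [Function.comp_def] at h3
    exact h3.congr_deriv (by ring)
  have hbound : ∀ θ : ℝ, ‖M⁻¹ * ζ' (M⁻¹ * (s + θ - y₀)) - M⁻¹ * ζ' (M⁻¹ * (s' + θ - y₀))‖ ≤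
      M⁻¹ ^ 2 * D₂ * |s - s'| := by
    intro θ
    have hid : M⁻¹ * (s + θ - y₀) - M⁻¹ * (s' + θ - y₀) = M⁻¹ * (s - s') := by ring
    rw [Real.norm_eq_abs, ← mul_sub, abs_mul, abs_of_pos (inv_pos.2 hM)]
    calc M⁻¹ * |ζ' (M⁻¹ * (s + θ - y₀)) - ζ' (M⁻¹ * (s' + θ - y₀))|
        ≤ M⁻¹ * (D₂ * |M⁻¹ * (s + θ - y₀) - M⁻¹ * (s' + θ - y₀)|) :=
          mul_le_mul_of_nonneg_left (hLip' _ _) (inv_pos.2 hM).le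
      _ = M⁻¹ ^ 2 * D₂ * |s - s'| := by rw [hid, abs_mul, abs_of_pos (inv_pos.2 hM)]; ring
  have hmv : ‖(ζ (M⁻¹ * (s + η - y₀)) - ζ (M⁻¹ * (s' + η - y₀))) -
      (ζ (M⁻¹ * (s + 0 - y₀)) - ζ (M⁻¹ * (s' + 0 - y₀)))‖ ≤ M⁻¹ ^ 2 * D₂ * |s - s'| * ‖η - 0‖ :=
    convex_univ.norm_image_sub_le_of_norm_hasDerivWithin_le
      (f := fun θ : ℝ => ζ (M⁻¹ * (s + θ - y₀)) - ζ (M⁻¹ * (s' + θ - y₀)))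
      (fun θ _ => (hr' θ).hasDerivWithinAt) (fun θ _ => hbound θ) (Set.mem_univ 0) (Set.mem_univ η)
  -- `w s − w s′ = η⁻¹ (r η − r 0)`
  have hid : axisQuot ζ M y₀ η s - axisQuot ζ M y₀ η s' = η⁻¹ * ((ζ (M⁻¹ * (s + η - y₀)) - ζ (M⁻¹ * (s' + η - y₀))) -
      (ζ (M⁻¹ * (s + 0 - y₀)) - ζ (M⁻¹ * (s' + 0 - y₀)))) := by
    simp only [axisQuot, add_zero]; ring
  rw [hid, abs_mul, abs_inv]
  rw [Real.norm_eq_abs, Real.norm_eq_abs, sub_zero] at hmv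
  have hη' : 0 < |η| := abs_pos.2 hη
  calc |η|⁻¹ * |(ζ (M⁻¹ * (s + η - y₀)) - ζ (M⁻¹ * (s' + η - y₀))) -
        (ζ (M⁻¹ * (s + 0 - y₀)) - ζ (M⁻¹ * (s' + 0 - y₀)))|
      ≤ |η|⁻¹ * (M⁻¹ ^ 2 * D₂ * |s - s'| * |η|) := mul_le_mul_of_nonneg_left hmv (inv_nonneg.2 hη'.le)
    _ = M⁻¹ ^ 2 * D₂ * |s - s'| := by field_simp

/-- **The lattice gradient of `ζ_□` is `ℓ¹`-Lipschitz with constant `M⁻²(D₂ + D²)`**: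
`|∇_νζ_□(x) − ∇_νζ_□(x′)| ≤ M⁻²(D₂ + D²)|x − x′|₁` — from the factorization `∇_νζ_□ = w(x_ν)P_ν(x)`, `|w| ≤ M⁻¹D`,
`Lip(w) ≤ M⁻²D₂`, `|P_ν| ≤ 1`, `Lip(P_ν) ≤ M⁻¹D`. [cite: Balaban1987RG1, (3.31) p.276] (our proof) -/
theorem abs_gradCube_sub_le {ζ ζ' : ℝ → ℝ} {D D₂ M : ℝ} (h01 : ∀ s, 0 ≤ ζ s ∧ ζ s ≤ 1)
    (hLip : ∀ s s', |ζ s - ζ s'| ≤ D * |s - s'|) (hder : ∀ s, HasDerivAt ζ (ζ' s) s)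
    (hLip' : ∀ s s', |ζ' s - ζ' s'| ≤ D₂ * |s - s'|) (hM : 0 < M) (hD : 0 ≤ D) (hD₂ : 0 ≤ D₂) {η : ℝ} (hη : η ≠ 0)
    (y : Fin d → ℝ) (ν : Fin d) (x x' : Fin d → ℝ) :
    |gradCube ζ M y ν η x - gradCube ζ M y ν η x'| ≤ M⁻¹ ^ 2 * (D₂ + D ^ 2) * l1 x x' := by
  rw [gradCube_eq, gradCube_eq]
  have hw := abs_axisQuot_sub_le hder hLip' hM hη (y ν) (x ν) (x' ν)
  have hw' := abs_axisQuot_le hLip hM hη (y ν) (x' ν)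
  have hP := abs_perpProd_le_one h01 M y ν x
  have hP' := abs_perpProd_sub_le h01 hLip hM hD y ν x x'
  have hl := abs_sub_le_l1 x x' ν
  have hl0 := l1_nonneg x x'
  have hM' : 0 ≤ M⁻¹ := (inv_pos.2 hM).le
  -- `a b − a′ b′ = (a − a′) b + a′ (b − b′)`
  have hid : axisQuot ζ M (y ν) η (x ν) * perpProd ζ M y ν x - axisQuot ζ M (y ν) η (x' ν) * perpProd ζ M y ν x' =
      (axisQuot ζ M (y ν) η (x ν) - axisQuot ζ M (y ν) η (x' ν)) * perpProd ζ M y ν x +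
        axisQuot ζ M (y ν) η (x' ν) * (perpProd ζ M y ν x - perpProd ζ M y ν x') := by ring
  rw [hid]
  refine (abs_add_le _ _).trans ?_
  rw [abs_mul, abs_mul]
  calc |axisQuot ζ M (y ν) η (x ν) - axisQuot ζ M (y ν) η (x' ν)| * |perpProd ζ M y ν x| +
        |axisQuot ζ M (y ν) η (x' ν)| * |perpProd ζ M y ν x - perpProd ζ M y ν x'|
      ≤ M⁻¹ ^ 2 * D₂ * |x ν - x' ν| * 1 + M⁻¹ * D * (M⁻¹ * D * l1 x x') :=
        add_le_add (mul_le_mul hw hP (abs_nonneg _) (by positivity))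
          (mul_le_mul hw' hP' (abs_nonneg _) (by positivity))
    _ ≤ M⁻¹ ^ 2 * D₂ * l1 x x' * 1 + M⁻¹ * D * (M⁻¹ * D * l1 x x') := by gcongr
    _ = M⁻¹ ^ 2 * (D₂ + D ^ 2) * l1 x x' := by ring

/-- Hölder form: for `0 < |x − x′|₁ ≤ 1` and `β ≤ 1`, `|∇_νζ_□(x) − ∇_νζ_□(x′)| ≤ M⁻²(D₂ + D²)|x − x′|₁^β`.
[cite: Balaban1987RG1, (3.31) p.276] (our proof) -/
theorem abs_gradCube_sub_le_rpow {ζ ζ' : ℝ → ℝ} {D D₂ M β : ℝ} (h01 : ∀ s, 0 ≤ ζ s ∧ ζ s ≤ 1)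
    (hLip : ∀ s s', |ζ s - ζ s'| ≤ D * |s - s'|) (hder : ∀ s, HasDerivAt ζ (ζ' s) s)
    (hLip' : ∀ s s', |ζ' s - ζ' s'| ≤ D₂ * |s - s'|) (hM : 0 < M) (hD : 0 ≤ D) (hD₂ : 0 ≤ D₂) {η : ℝ} (hη : η ≠ 0)
    (hβ1 : β ≤ 1) (y : Fin d → ℝ) (ν : Fin d) (x x' : Fin d → ℝ) (hpos : 0 < l1 x x') (hle : l1 x x' ≤ 1) :
    |gradCube ζ M y ν η x - gradCube ζ M y ν η x'| ≤ M⁻¹ ^ 2 * (D₂ + D ^ 2) * l1 x x' ^ β := by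
  refine (abs_gradCube_sub_le h01 hLip hder hLip' hM hD hD₂ hη y ν x x').trans (mul_le_mul_of_nonneg_left ?_ ?_)
  · simpa using Real.rpow_le_rpow_of_exponent_ge hpos hle hβ1
  · positivity

/-- **The constants exist for the constructed profile** `B12PartitionUnity270.zeta` (`C^∞` with compact support): there
are `D, D₂ ≥ 0` with `|ζ′| ≤ D`, `ζ` `D`-Lipschitz and `ζ′` `D₂`-Lipschitz (and `0 ≤ ζ ≤ 1` is
`B12PartitionUnity270.zeta_nonneg`/`zeta_le_one`).  The values are not computed (the print's «bounded by 5» is a located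
slip for the second derivative, `B12PartitionUnity270.zeta_not_deriv2_le_five`). [cite: Balaban1987RG1, §3 p.270] (our proof) -/
theorem zeta_profile_constants : ∃ D D₂ : ℝ, 0 ≤ D ∧ 0 ≤ D₂ ∧
    (∀ s, HasDerivAt B12PartitionUnity270.zeta (deriv B12PartitionUnity270.zeta s) s) ∧
    (∀ s, |deriv B12PartitionUnity270.zeta s| ≤ D) ∧
    (∀ s s', |B12PartitionUnity270.zeta s - B12PartitionUnity270.zeta s'| ≤ D * |s - s'|) ∧
    (∀ s s', |deriv B12PartitionUnity270.zeta s - deriv B12PartitionUnity270.zeta s'| ≤ D₂ * |s - s'|) := by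
  have h2 : ContDiff ℝ 2 B12PartitionUnity270.zeta := B12PartitionUnity270.contDiff_zeta
  have hdiff : Differentiable ℝ B12PartitionUnity270.zeta := h2.differentiable (by norm_num)
  have h1' : ContDiff ℝ 1 (deriv B12PartitionUnity270.zeta) := by
    have : ContDiff ℝ ((1 : ℕ∞) + 1) B12PartitionUnity270.zeta := B12PartitionUnity270.contDiff_zeta
    exact this.deriv'
  have hdiff' : Differentiable ℝ (deriv B12PartitionUnity270.zeta) := h1'.differentiable one_ne_zero
  have hcont' : Continuous (deriv B12PartitionUnity270.zeta) := h1'.continuous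
  have hcont'' : Continuous (deriv (deriv B12PartitionUnity270.zeta)) := h1'.continuous_deriv le_rfl
  have hsupp' : HasCompactSupport (deriv B12PartitionUnity270.zeta) := B12PartitionUnity270.hasCompactSupport_zeta.deriv
  have hsupp'' : HasCompactSupport (deriv (deriv B12PartitionUnity270.zeta)) := hsupp'.deriv
  obtain ⟨D, hD⟩ := hcont'.bounded_above_of_compact_support hsupp'
  obtain ⟨D₂, hD₂⟩ := hcont''.bounded_above_of_compact_support hsupp''
  have hD0 : 0 ≤ D := (norm_nonneg _).trans (hD 0)
  have hD₂0 : 0 ≤ D₂ := (norm_nonneg _).trans (hD₂ 0)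
  refine ⟨D, D₂, hD0, hD₂0, fun s => (hdiff s).hasDerivAt, fun s => ?_, fun s s' => ?_, fun s s' => ?_⟩
  · simpa [Real.norm_eq_abs] using hD s
  · have h := convex_univ.norm_image_sub_le_of_norm_deriv_le (f := B12PartitionUnity270.zeta) (fun x _ => hdiff x)
      (fun x _ => hD x) (Set.mem_univ s') (Set.mem_univ s)
    simpa [Real.norm_eq_abs] using h
  · have h := convex_univ.norm_image_sub_le_of_norm_deriv_le (f := deriv B12PartitionUnity270.zeta)
      (fun x _ => hdiff' x) (fun x _ => hD₂ x) (Set.mem_univ s') (Set.mem_univ s)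
    simpa [Real.norm_eq_abs] using h

end Cube

/-! ## §6  The concrete bond carrier (base point, direction): (3.31) for `(tζ̃_□ + t_□ζ_□)F` with the `ζ_□`-inputs
DISCHARGED and the `ζ̃_□`-inputs displayed -/

section Carrier

open Finset

variable {d : ℕ}

/-- Bonds of the `η`-lattice as (base point, direction) pairs `b = (x, μ)` = `⟨x, x + ηe_μ⟩`; the base point is taken in
`ℝ^d` (lattice membership is not needed for the estimates). [cite: Balaban1987RG1, (3.31) p.276] -/
abbrev Bond (d : ℕ) := (Fin d → ℝ) × Fin d

/-- Gradient indices `k = (b, ν)`: the bond `b` and the direction `ν` of differentiation (B5 (1.108) `∂_νA_μ(x)`).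
[cite: Balaban1984PropagatorsI, (1.108) p.35] -/
abbrev GIdx (d : ℕ) := Bond d × Fin d

/-- Source bond of a gradient index: `b` itself. [cite: Balaban1984PropagatorsI, (1.108) p.35] -/
def gsrc : GIdx d → Bond d := fun k => k.1

/-- Target bond of a gradient index: the bond translated by `ηe_ν`. [cite: Balaban1984PropagatorsI, (1.108) p.35] -/
def gtgt (η : ℝ) : GIdx d → Bond d := fun k => (shiftPt k.1.1 k.2 η, k.1.2)

/-- The scale `η⁻¹` of the lattice derivative (as a complex scalar). [cite: Balaban1984PropagatorsI, (1.108) p.35] -/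
noncomputable def gscale (η : ℝ) : GIdx d → ℂ := fun _ => ((η⁻¹ : ℝ) : ℂ)

/-- Distance of two gradient indices = `ℓ¹` distance of the base points. [cite: Balaban1984PropagatorsI, (1.109) p.35] -/
noncomputable def gdist : GIdx d → GIdx d → ℝ := fun k k' => l1 k.1.1 k'.1.1

/-- «same indices» (bond direction `μ` and derivative direction `ν`) — only such values are compared in B5's `max_{μ,ν}
sup`. [cite: Balaban1984PropagatorsI, (1.109) p.35] -/
def sameIdx : GIdx d → GIdx d → Prop := fun k k' => k.1.2 = k'.1.2 ∧ k.2 = k'.2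

/-- B5 (1.109) admissibility: same indices and `|x − x′| ≤ 1`. [cite: Balaban1984PropagatorsI, (1.109) p.35] -/
def admB5 : GIdx d → GIdx d → Prop := fun k k' => sameIdx k k' ∧ gdist k k' ≤ 1

/-- On this carrier `LatticeNorms.holderSeminormB5 β sameIdx gdist` IS the identity-transport Hölder seminorm with
admissibility `admB5` (definitional). [cite: Balaban1984PropagatorsI, (1.109) p.35] -/
theorem holderSeminormB5_eq {E : Type*} [SeminormedAddCommGroup E] (β : ℝ) (K : Finset (GIdx d)) (f : GIdx d → E) :
    holderSeminormB5 β sameIdx gdist K f = holderSeminorm β admB5 gdist (fun _ _ => id) K f := rfl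

/-- The cut-off `ζ_□` as a complex-valued bond function (value at the base point of the bond).
[cite: Balaban1987RG1, §3 p.270] -/
noncomputable def cubeCutoffC (ζ : ℝ → ℝ) (M : ℝ) (y : Fin d → ℝ) : Bond d → ℂ :=
  fun b => (cubeCutoff ζ M y b.1 : ℂ)

/-- Input (a) for `ζ_□`: `|ζ_□| ≤ 1`. [cite: Balaban1987RG1, §3 p.270] -/
theorem norm_cubeCutoffC_le_one {ζ : ℝ → ℝ} (h01 : ∀ s, 0 ≤ ζ s ∧ ζ s ≤ 1) (M : ℝ) (y : Fin d → ℝ) (b : Bond d) :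
    ‖cubeCutoffC ζ M y b‖ ≤ 1 := by
  rw [cubeCutoffC, Complex.norm_real, Real.norm_eq_abs]
  exact abs_cubeCutoff_le_one h01 M y b.1

/-- The abstract gradient of `ζ_□` on this carrier is the lattice gradient `∇_νζ_□` of §5.
[cite: Balaban1987RG1, (3.31) p.276] -/
theorem grad_cubeCutoffC (ζ : ℝ → ℝ) (M : ℝ) (y : Fin d → ℝ) (η : ℝ) (k : GIdx d) :
    grad (gscale η) gsrc (gtgt η) (cubeCutoffC ζ M y) k = ((gradCube ζ M y k.2 η k.1.1 : ℝ) : ℂ) := by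
  simp only [grad, gscale, gsrc, gtgt, cubeCutoffC, gradCube, smul_eq_mul]
  push_cast
  ring

/-- Input (b) for `ζ_□`: `|∇^ηζ_□| ≤ M⁻¹D`. [cite: Balaban1987RG1, (3.31) p.276] -/
theorem norm_grad_cubeCutoffC_le {ζ : ℝ → ℝ} {D M : ℝ} (h01 : ∀ s, 0 ≤ ζ s ∧ ζ s ≤ 1)
    (hLip : ∀ s s', |ζ s - ζ s'| ≤ D * |s - s'|) (hM : 0 < M) {η : ℝ} (hη : η ≠ 0) (y : Fin d → ℝ) (k : GIdx d) :
    ‖grad (gscale η) gsrc (gtgt η) (cubeCutoffC ζ M y) k‖ ≤ M⁻¹ * D := by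
  rw [grad_cubeCutoffC, Complex.norm_real, Real.norm_eq_abs]
  exact abs_gradCube_le h01 hLip hM hη y k.2 k.1.1

/-- Input (c) for `ζ_□`: the Hölder seminorm (B5 admissibility) of `ζ_□` along the targets is `≤ M⁻¹D`.
[cite: Balaban1987RG1, (3.31) p.276] -/
theorem holderSeminorm_cubeCutoffC_tgt_le {ζ : ℝ → ℝ} {D M β : ℝ} (h01 : ∀ s, 0 ≤ ζ s ∧ ζ s ≤ 1)
    (hLip : ∀ s s', |ζ s - ζ s'| ≤ D * |s - s'|) (hM : 0 < M) (hD : 0 ≤ D) (hβ1 : β ≤ 1) (η : ℝ) (y : Fin d → ℝ)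
    (K : Finset (GIdx d)) :
    holderSeminorm β admB5 gdist (fun _ _ => id) K (fun k => cubeCutoffC ζ M y (gtgt η k)) ≤ M⁻¹ * D := by
  refine holderSeminorm_le (mul_nonneg (inv_pos.2 hM).le hD) fun k _ k' _ hadm hpos => ?_
  obtain ⟨⟨_, hν⟩, hle⟩ := hadm
  dsimp only [id]
  simp only [cubeCutoffC, gtgt, gdist] at hpos hle ⊢
  rw [← Complex.ofReal_sub, Complex.norm_real, Real.norm_eq_abs, ← hν]
  have h := abs_cubeCutoff_sub_le_rpow h01 hLip hM hD hβ1 y (shiftPt k'.1.1 k.2 η) (shiftPt k.1.1 k.2 η)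
    (by rwa [l1_shiftPt_shiftPt, l1_comm]) (by rwa [l1_shiftPt_shiftPt, l1_comm])
  rwa [l1_shiftPt_shiftPt, l1_comm] at h

/-- Input (d) for `ζ_□`: the Hölder seminorm (B5 admissibility) of `∇^ηζ_□` is `≤ M⁻²(D₂ + D²)`.
[cite: Balaban1987RG1, (3.31) p.276] -/
theorem holderSeminorm_grad_cubeCutoffC_le {ζ ζ' : ℝ → ℝ} {D D₂ M β : ℝ} (h01 : ∀ s, 0 ≤ ζ s ∧ ζ s ≤ 1)
    (hLip : ∀ s s', |ζ s - ζ s'| ≤ D * |s - s'|) (hder : ∀ s, HasDerivAt ζ (ζ' s) s)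
    (hLip' : ∀ s s', |ζ' s - ζ' s'| ≤ D₂ * |s - s'|) (hM : 0 < M) (hD : 0 ≤ D) (hD₂ : 0 ≤ D₂) {η : ℝ} (hη : η ≠ 0)
    (hβ1 : β ≤ 1) (y : Fin d → ℝ) (K : Finset (GIdx d)) :
    holderSeminorm β admB5 gdist (fun _ _ => id) K (grad (gscale η) gsrc (gtgt η) (cubeCutoffC ζ M y)) ≤
      M⁻¹ ^ 2 * (D₂ + D ^ 2) := by
  refine holderSeminorm_le (by positivity) fun k _ k' _ hadm hpos => ?_
  obtain ⟨⟨_, hν⟩, hle⟩ := hadm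
  dsimp only [id]
  simp only [gdist] at hpos hle ⊢
  rw [grad_cubeCutoffC, grad_cubeCutoffC, ← Complex.ofReal_sub, Complex.norm_real, Real.norm_eq_abs, ← hν]
  have h := abs_gradCube_sub_le_rpow h01 hLip hder hLip' hM hD hD₂ hη hβ1 y k.2 k'.1.1 k.1.1
    (by rwa [l1_comm]) (by rwa [l1_comm])
  rwa [l1_comm] at h

/-- **THE PRINTED SENTENCE ON THE CONCRETE CARRIER** — *«Obviously such bounds are satisfied by the function
(tζ̃_□ + t_□ζ_□)𝐇_k(B′) for ε₁ sufficiently small»*: for the printed product cut-off `ζ_□` of p. 270 (any profile with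
`0 ≤ ζ ≤ 1`, `ζ` `D`-Lipschitz, `ζ′` `D₂`-Lipschitz — such constants exist for the constructed profile,
`zeta_profile_constants`), an arbitrary second cut-off `ζ̃_□` with DISPLAYED regularity data (`|ζ̃_□| ≤ 1`, gradients
`≤ ℓ`, Hölder data `≤ ℓ′, ℓ″`; print gives no formula for `ζ̃_□`), `|t| ≤ 1`, `|t_□| ≤ r`, and `F = 𝐇_k(B′)` with the
DISPLAYED `ε₁`-linear inputs, if `ℓ ≥ M⁻¹D`, `ℓ′ ≥ M⁻¹D`, `ℓ″ ≥ M⁻²(D₂ + D²)` and `(1 + r)(1 + ℓ + ℓ′ + ℓ″)·C·ε₁ < α₂`, then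
`𝐀 = (tζ̃_□ + t_□ζ_□)F` satisfies all three members of (3.31): `|𝐀| < α₂` on `S`, `|∇^η𝐀| < α₂` on `K`,
`‖𝐀‖_{1,β} = ‖∇^η𝐀‖_β < α₂` on `K` (B5 (1.109) admissibility `sameIdx`, `ℓ¹` distance).
[cite: Balaban1987RG1, (3.31) p.276] -/
theorem ineq331_cube_of_small {𝔸 : Type*} [SeminormedAddCommGroup 𝔸] [NormedSpace ℂ 𝔸]
    (S : Finset (Bond d)) (K : Finset (GIdx d)) {β η M D D₂ : ℝ} {ζ ζ' : ℝ → ℝ} (y : Fin d → ℝ)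
    (h01 : ∀ s, 0 ≤ ζ s ∧ ζ s ≤ 1) (hLip : ∀ s s', |ζ s - ζ s'| ≤ D * |s - s'|) (hder : ∀ s, HasDerivAt ζ (ζ' s) s)
    (hLip' : ∀ s s', |ζ' s - ζ' s'| ≤ D₂ * |s - s'|) (hM : 0 < M) (hD : 0 ≤ D) (hD₂ : 0 ≤ D₂) (hη : η ≠ 0)
    (hβ1 : β ≤ 1)
    {ζt : Bond d → ℂ} {t tb : ℂ} {r ℓ ℓ' ℓ'' C ε₁ α₂ : ℝ} (hζt : ∀ b, ‖ζt b‖ ≤ 1) (ht : ‖t‖ ≤ 1) (htb : ‖tb‖ ≤ r)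
    (hℓ : M⁻¹ * D ≤ ℓ) (hℓ' : M⁻¹ * D ≤ ℓ') (hℓ'' : M⁻¹ ^ 2 * (D₂ + D ^ 2) ≤ ℓ'')
    (hdζt : ∀ k ∈ K, ‖grad (gscale η) gsrc (gtgt η) ζt k‖ ≤ ℓ)
    (hhζt : holderSeminormB5 β sameIdx gdist K (fun k => ζt (gtgt η k)) ≤ ℓ')
    (hhdζt : holderSeminormB5 β sameIdx gdist K (grad (gscale η) gsrc (gtgt η) ζt) ≤ ℓ'')
    (F : Bond d → 𝔸) (hF₀ : ∀ b, ‖F b‖ ≤ C * ε₁)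
    (hF₁ : ∀ k ∈ K, ‖grad (gscale η) gsrc (gtgt η) F k‖ ≤ C * ε₁)
    (hF₂ : holderSeminormB5 β sameIdx gdist K (grad (gscale η) gsrc (gtgt η) F) ≤ C * ε₁)
    (hF₃ : holderSeminormB5 β sameIdx gdist K (fun k => F (gsrc k)) ≤ C * ε₁)
    (hsmall : (1 + r) * (1 + ℓ + ℓ' + ℓ'') * C * ε₁ < α₂) :
    supNorm S (fun b => cutoff t tb ζt (cubeCutoffC ζ M y) b • F b) < α₂ ∧
      supNorm K (grad (gscale η) gsrc (gtgt η) (fun b => cutoff t tb ζt (cubeCutoffC ζ M y) b • F b)) < α₂ ∧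
        holderSeminormB5 β sameIdx gdist K
          (grad (gscale η) gsrc (gtgt η) (fun b => cutoff t tb ζt (cubeCutoffC ζ M y) b • F b)) < α₂ := by
  have hℓ0 : 0 ≤ ℓ := (mul_nonneg (inv_pos.2 hM).le hD).trans hℓ
  have hℓ''0 : 0 ≤ ℓ'' := le_trans (by positivity) hℓ''
  simp only [holderSeminormB5_eq] at hhζt hhdζt hF₂ hF₃ ⊢
  exact ineq331_cutoff_of_small S β admB5 gdist K (gscale η) gsrc (gtgt η) F hζt (norm_cubeCutoffC_le_one h01 M y) ht
    htb hℓ0 hℓ''0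
    (fun k hk => ⟨hdζt k hk, (norm_grad_cubeCutoffC_le h01 hLip hM hη y k).trans hℓ⟩) hhζt
    ((holderSeminorm_cubeCutoffC_tgt_le h01 hLip hM hD hβ1 η y K).trans hℓ') hhdζt
    ((holderSeminorm_grad_cubeCutoffC_le h01 hLip hder hLip' hM hD hD₂ hη hβ1 y K).trans hℓ'') hF₀ hF₁ hF₂ hF₃ hsmall

end Carrier

end Literature.MathematicalPhysics.QuantumFieldTheory.Balaban1983to89.B12Ineq331Cutoff
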